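import Mathlib
import HarnessLib

/-!
# Hilbert–Schmidt separability probabilities of two-rebit and two-qubit states
# (Lovas–Andai 2017: `29/64`; Huong–Khoi 2024 / Zhang–Jiang–Xie 2025: `8/33`)

Topic `Literature/Probability/RandomMatrix` (Hilbert–Schmidt = Lebesgue volumes of spectrahedra of
quantum states, Życzkowski–Sommers). NAMED FACTS (D-0014, statements only, `def … : Prop`),
requested by route `Summit.KontsevichZagierPeriods.KontsevichZagierPeriods.Theses.SeparabilityScissors`
(items `Target` stmt-KontsevichZagierPeriods-8487, `QubitCore833` -8488, `RebitCore2964` -8489,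
`SectorOfSummit` -8493), whose statements quantify over exactly the coordinate charts used here.

## What is printed

* A. Lovas, A. Andai, *Invariance of separability probability over reduced states in 4 × 4
  bipartite systems*, J. Phys. A 50 (2017) 295303 [LovasAndai2017] (held: arXiv:1610.01410, read
  §2–3). State space `𝒟_{4,𝕂} = {D ∈ 𝕂^{4×4} | D = D*, D > 0, Tr D = 1}` (faithful states, §2),
  parametrised `ρ(D₁, D₂, C) = [[D₁, C], [C*, D₂]]` with `Tr₂ ρ = D₁ + D₂` (§3); the involution
  `T(ρ(D₁,D₂,C)) = ρ(D₁,D₂,C*)` and "the Peres–Horodecki positive partial transpose criterion can be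
  reformulated as `𝒟ˢ_{4,𝕂} = T(𝒟_{4,𝕂}) ∩ 𝒟_{4,𝕂}`"; volumes are Lebesgue measures `λ_{6d+3}`,
  `λ_{4d}` of these parameter sets (`d = dim_ℝ 𝕂`), fibres `𝒟_{4,𝕂}(D) = {ρ : Tr₂ ρ = D}`.
  **Corollary 2**: "If `D ∈ 𝒟_{2,𝕂}` is a fixed density matrix, then the probability to find a
  separable state in `𝒟_{4,𝕂}(D)` can be written as `𝒫_sep(𝕂) = ∫ χ̃_d ∘ σ(√((I−Y)/(I+Y))) dμ_{d+2}(Y)`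
  … this probability does not depend on `D`" (proof: it is `Vol(𝒟ˢ_{4,𝕂}(D)) / Vol(𝒟_{4,𝕂}(D))`).
  **Theorem 2**: "The separability probability in the rebit-rebit system with respect to the
  Hilbert–Schmidt measure is `𝒫_sep(ℝ) = 29/64`."
* H. Thanh Huong, V. The Khoi, *Separability probability of two-qubit states*, J. Phys. A 57
  (2024) 445304 [HuongKhoi2024] (paywalled; statement read through the re-derivation below):
  the Hilbert–Schmidt separability probability of two-qubit states is `8/33`.
* L. Zhang, X. Jiang, B. Xie, *One application of Duistermaat–Heckman measure in quantum
  information theory*, Quantum Inf. Comput. 25 (2025) 598–632 [ZhangJiangXie2025] (held: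
  arXiv:2507.02369, read §6). `P^{(n×m)}_sep := vol_HS(D_sep(ℂⁿ⊗ℂᵐ)) / vol_HS(D(ℂⁿ⊗ℂᵐ))` (§6.2);
  `D⁰` = two-qubit states whose single-qubit reduced state has Bloch vector `0` (is `½·1₂`),
  `D_ss := {ρ : λ_max(ρ) ≤ ½}`; **Prop. 6.9** ([Huong2024]): for `ρ ∈ D⁰`, `ρ` is separable iff
  `ρ ∈ D_ss`; **Prop. 6.7** ([Lovas2017]): `vol_HS(D⁰) = π⁵/9676800`; **Prop. 6.10** ([Huong2024]):
  `f(a) = vol_HS(Dᵃ ∩ D_ss) = π⁵/319334400 · (1−a)⁹(33a³+162a²+72a+8)`; **Theorem 6.12**: "The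
  separability probability of all two-qubit states is given by `P^{(2×2)}_sep = 8/33`", proved as
  `P_sep = P_sep(0) = f(0) / vol_HS(D⁰) = (π⁵/39916800)/(π⁵/9676800) = 8/33`.

## Rendering

* Charts. A real symmetric / complex Hermitian `4 × 4` matrix of trace `1` is written in the affine
  coordinates of its entries (diagonal entries and real/imaginary parts of the upper off-diagonal
  entries, the last diagonal entry eliminated by the trace), `y ∈ ℝ⁹` resp. `y ∈ ℝ¹⁵`; the fibre
  `Tr₂ ρ = ½·1₂` (`D₂ = ½·1 − D₁`) in the coordinates of `(D₁, C)`, `x ∈ ℝ⁷` resp. `x ∈ ℝ¹²`. These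
  are exactly the charts of the route file. The Hilbert–Schmidt measure on each of these affine
  spaces is a CONSTANT multiple of the coordinate Lebesgue measure `volume` on `Fin n → ℝ` (the HS
  metric is a fixed positive quadratic form in the coordinates), so every printed RATIO of volumes
  of two subsets of the same space is the ratio of their `volume`s; the facts are stated
  cross-multiplied in `ℝ≥0∞` (all sets are bounded).
* Partial transpose "on the first factor" of `ρ = [[X, Z], [Z*, Y]]` (blocks indexed by the first
  factor) is `[[X, Z*], [Z, Y]]` = Lovas–Andai's `T`; Zhang–Jiang–Xie's `ρ^Γ` (partial transpose
  w.r.t. the 1st subsystem) is the same matrix.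
* Lovas–Andai work with FAITHFUL states and the OPEN bodies `D > 0`, `T(D) > 0` (`Matrix.PosDef`);
  Zhang–Jiang–Xie / Huong–Khoi with density matrices (`Matrix.PosSemidef`, closed bodies). Each
  fact is typed with the positivity notion of its source; the two versions of each body differ by
  a subset of the real algebraic hypersurface `{det ρ · det ρ^Γ = 0}` (Lebesgue-null), which is NOT
  asserted here.
* Which single-qubit marginal is fixed in a fibre is immaterial for the volumes (the factor swap is
  a coordinate permutation preserving `volume`, positivity, `T` and `λ_max`); the fibre facts are
  typed on the route's fibre `D₁ + D₂ = ½·1₂`.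

## Tree search

`lean search 'LovasAndai|HuongKhoi|separab.*qubit|PosSemidef.*volume'`: nothing on volumes of
sets of positive semidefinite matrices or quantum states in Mathlib/Literature; the KZ calculus
(`Literature.NumberTheory.Transcendental.KZ.IntegralRep.value = ∫ x in domain, integrand x`) is
the consumer: for a constant integrand `c` on domain `σ`, `value = c · (volume σ).toReal`.

## References

* [LovasAndai2017] Lovas–Andai, J. Phys. A 50 (2017) 295303, §2 (Def. of `𝒟_{n,𝕂}`), §3
  (parametrisation, `T`, Thm. 1, Cor. 1–2, Thm. 2). arXiv:1610.01410.
* [HuongKhoi2024] Huong–Khoi, J. Phys. A 57 (2024) 445304 (main theorem: `8/33`).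
* [ZhangJiangXie2025] Zhang–Jiang–Xie, QIC 25 (2025) 598–632, §6: Props. 6.5–6.10, Thms. 6.8, 6.12.
  arXiv:2507.02369.
-/

noncomputable section

open MeasureTheory
open scoped ENNReal ComplexOrder Matrix

namespace Literature.Probability.RandomMatrix

/-! ### Charts -/

/-- The trace-one real symmetric `4 × 4` matrix with entry coordinates `y ∈ ℝ⁹`:
`X = [[y0, y2], [y2, y1]]`, `Y = [[y3, y4], [y4, 1 − y0 − y1 − y3]]`, `Z = [[y5, y6], [y7, y8]]`,
`ρ = [[X, Z], [Zᵀ, Y]]` (two-rebit "density matrix" before positivity is imposed; the chart of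
route SeparabilityScissors). [cite: LovasAndai2017, §3 (parametrisation ρ(D₁,D₂,C))] -/
def twoRebitMatrix (y : Fin 9 → ℝ) : Matrix (Fin 4) (Fin 4) ℝ :=
  !![y 0, y 2, y 5, y 6; y 2, y 1, y 7, y 8; y 5, y 7, y 3, y 4; y 6, y 8, y 4, 1 - y 0 - y 1 - y 3]

/-- Its partial transpose on the first factor, `T ρ = [[X, Zᵀ], [Z, Y]]` (Lovas–Andai's involution
`ρ(D₁,D₂,C) ↦ ρ(D₁,D₂,C*)`). [cite: LovasAndai2017, §3 (the involution T)] -/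
def twoRebitMatrixPT (y : Fin 9 → ℝ) : Matrix (Fin 4) (Fin 4) ℝ :=
  !![y 0, y 2, y 5, y 7; y 2, y 1, y 6, y 8; y 5, y 6, y 3, y 4; y 7, y 8, y 4, 1 - y 0 - y 1 - y 3]

/-- The trace-one complex Hermitian `4 × 4` matrix with entry coordinates `y ∈ ℝ¹⁵`:
`X = [[y0, y2 + y3 i], [·, y1]]`, `Y = [[y4, y5 + y6 i], [·, 1 − y0 − y1 − y4]]`,
`Z = [[y7 + y8 i, y9 + y10 i], [y11 + y12 i, y13 + y14 i]]`, `ρ = [[X, Z], [Z*, Y]]` (chart of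
route SeparabilityScissors). [cite: LovasAndai2017, §3 (parametrisation ρ(D₁,D₂,C))] -/
def twoQubitMatrix (y : Fin 15 → ℝ) : Matrix (Fin 4) (Fin 4) ℂ :=
  !![((y 0 : ℝ) : ℂ), (⟨y 2, y 3⟩ : ℂ), (⟨y 7, y 8⟩ : ℂ), (⟨y 9, y 10⟩ : ℂ);
     (⟨y 2, -y 3⟩ : ℂ), ((y 1 : ℝ) : ℂ), (⟨y 11, y 12⟩ : ℂ), (⟨y 13, y 14⟩ : ℂ);
     (⟨y 7, -y 8⟩ : ℂ), (⟨y 11, -y 12⟩ : ℂ), ((y 4 : ℝ) : ℂ), (⟨y 5, y 6⟩ : ℂ);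
     (⟨y 9, -y 10⟩ : ℂ), (⟨y 13, -y 14⟩ : ℂ), (⟨y 5, -y 6⟩ : ℂ), ((1 - y 0 - y 1 - y 4 : ℝ) : ℂ)]

/-- Its partial transpose on the first factor, `ρ^Γ = [[X, Z*], [Z, Y]]`.
[cite: ZhangJiangXie2025, §6.2 (ρ^Γ, partial transpose w.r.t. the 1st subsystem)] -/
def twoQubitMatrixPT (y : Fin 15 → ℝ) : Matrix (Fin 4) (Fin 4) ℂ :=
  !![((y 0 : ℝ) : ℂ), (⟨y 2, y 3⟩ : ℂ), (⟨y 7, -y 8⟩ : ℂ), (⟨y 11, -y 12⟩ : ℂ);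
     (⟨y 2, -y 3⟩ : ℂ), ((y 1 : ℝ) : ℂ), (⟨y 9, -y 10⟩ : ℂ), (⟨y 13, -y 14⟩ : ℂ);
     (⟨y 7, y 8⟩ : ℂ), (⟨y 9, y 10⟩ : ℂ), ((y 4 : ℝ) : ℂ), (⟨y 5, y 6⟩ : ℂ);
     (⟨y 11, y 12⟩ : ℂ), (⟨y 13, y 14⟩ : ℂ), (⟨y 5, -y 6⟩ : ℂ), ((1 - y 0 - y 1 - y 4 : ℝ) : ℂ)]

/-- The fibre chart `x ∈ ℝ⁷` of two-rebit matrices with maximally mixed marginal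
`D₁ + D₂ = ½·1₂`: `X = [[x0, x2], [x2, x1]]`, `Z = [[x3, x4], [x5, x6]]`, `ρ = [[X, Z], [Zᵀ, ½ − X]]`
(Lovas–Andai's `𝒟_{4,ℝ}(½·1)` in the coordinates `(D₁, C)`; chart of `RebitCore2964`).
[cite: LovasAndai2017, §3 (the fibre 𝒟_{4,𝕂}(D), eq. for Tr₂)] -/
def rebitFibreMatrix (x : Fin 7 → ℝ) : Matrix (Fin 4) (Fin 4) ℝ :=
  !![x 0, x 2, x 3, x 4; x 2, x 1, x 5, x 6; x 3, x 5, 1 / 2 - x 0, -x 2; x 4, x 6, -x 2, 1 / 2 - x 1]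

/-- Its partial transpose on the first factor (`Z ↦ Zᵀ`). [cite: LovasAndai2017, §3 (the involution T)] -/
def rebitFibreMatrixPT (x : Fin 7 → ℝ) : Matrix (Fin 4) (Fin 4) ℝ :=
  !![x 0, x 2, x 3, x 5; x 2, x 1, x 4, x 6; x 3, x 4, 1 / 2 - x 0, -x 2; x 5, x 6, -x 2, 1 / 2 - x 1]

/-- The fibre chart `x ∈ ℝ¹²` of two-qubit matrices with maximally mixed marginal
`D₁ + D₂ = ½·1₂`: `X = [[x0, x2 + x3 i], [·, x1]]`,
`Z = [[x4 + x5 i, x6 + x7 i], [x8 + x9 i, x10 + x11 i]]`, `ρ = [[X, Z], [Z*, ½ − X]]`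
(Zhang–Jiang–Xie's `D⁰`; chart of `QubitCore833`). [cite: ZhangJiangXie2025, §6.1 (the conditioned state space D^𝐫, 𝐫 = 0)] -/
def qubitFibreMatrix (x : Fin 12 → ℝ) : Matrix (Fin 4) (Fin 4) ℂ :=
  !![((x 0 : ℝ) : ℂ), (⟨x 2, x 3⟩ : ℂ), (⟨x 4, x 5⟩ : ℂ), (⟨x 6, x 7⟩ : ℂ);
     (⟨x 2, -x 3⟩ : ℂ), ((x 1 : ℝ) : ℂ), (⟨x 8, x 9⟩ : ℂ), (⟨x 10, x 11⟩ : ℂ);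
     (⟨x 4, -x 5⟩ : ℂ), (⟨x 8, -x 9⟩ : ℂ), ((1 / 2 - x 0 : ℝ) : ℂ), (⟨-x 2, -x 3⟩ : ℂ);
     (⟨x 6, -x 7⟩ : ℂ), (⟨x 10, -x 11⟩ : ℂ), (⟨-x 2, x 3⟩ : ℂ), ((1 / 2 - x 1 : ℝ) : ℂ)]

/-! ### Named facts -/

/-- **Lovas–Andai 2017, Theorem 2 (two-rebit separability probability `29/64`).** "The
separability probability in the rebit-rebit system with respect to the Hilbert–Schmidt measure is
`𝒫_sep(ℝ) = 29/64`", where `𝒫_sep(ℝ) = Vol(𝒟ˢ_{4,ℝ}) / Vol(𝒟_{4,ℝ})`, `𝒟_{4,ℝ}` the faithful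
(positive definite) trace-one real symmetric `4 × 4` matrices and `𝒟ˢ_{4,ℝ} = T(𝒟_{4,ℝ}) ∩ 𝒟_{4,ℝ}`
its PPT part (Peres–Horodecki). Rendered cross-multiplied on the entry chart `ℝ⁹` (module
docstring: constant Jacobian to the HS measure). [cite: LovasAndai2017, Theorem 2] -/
def LovasAndai2017_rebit_separability_probability : Prop :=
  64 * volume {y : Fin 9 → ℝ | (twoRebitMatrix y).PosDef ∧ (twoRebitMatrixPT y).PosDef} =
    29 * volume {y : Fin 9 → ℝ | (twoRebitMatrix y).PosDef}

/-- **Lovas–Andai 2017, Corollary 2 with Theorem 2 (the conditional two-rebit separability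
probability over the maximally mixed marginal is `29/64`).** Cor. 2: for a fixed faithful
`D ∈ 𝒟_{2,𝕂}` the probability `Vol(𝒟ˢ_{4,𝕂}(D)) / Vol(𝒟_{4,𝕂}(D))` of a separable (= PPT) state in
the fibre `𝒟_{4,𝕂}(D) = {ρ : Tr₂ ρ = D}` equals `𝒫_sep(𝕂)` and does not depend on `D`
(Milz–Strunz's conjecture); with Thm. 2 (`𝕂 = ℝ`) it is `29/64`. Rendered at `D = ½·1₂` on the
fibre chart `ℝ⁷` (`D₁ = X`, `C = Z`, `D₂ = ½ − X`), open bodies as printed.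
[cite: LovasAndai2017, Corollary 2 and Theorem 2] -/
def LovasAndai2017_rebit_fibre_separability_probability : Prop :=
  64 * volume {x : Fin 7 → ℝ | (rebitFibreMatrix x).PosDef ∧ (rebitFibreMatrixPT x).PosDef} =
    29 * volume {x : Fin 7 → ℝ | (rebitFibreMatrix x).PosDef}

/-- **Huong–Khoi 2024 (two-qubit separability probability `8/33`; Zhang–Jiang–Xie 2025,
Theorem 6.12).** "The separability probability of all two-qubit states is given by
`P^{(2×2)}_sep = vol_HS(D_sep(ℂ²⊗ℂ²)) / vol_HS(D(ℂ²⊗ℂ²)) = 8/33`" (density matrices: positive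
semidefinite, trace one; separable = PPT for two qubits, Peres–Horodecki, as used in §6.2 through
`ρ^Γ`). Rendered cross-multiplied on the entry chart `ℝ¹⁵`.
[cite: ZhangJiangXie2025, Theorem 6.12] [cite: HuongKhoi2024, main theorem] -/
def HuongKhoi2024_qubit_separability_probability : Prop :=
  33 * volume {y : Fin 15 → ℝ | (twoQubitMatrix y).PosSemidef ∧ (twoQubitMatrixPT y).PosSemidef} =
    8 * volume {y : Fin 15 → ℝ | (twoQubitMatrix y).PosSemidef}

/-- **Zhang–Jiang–Xie 2025, proof of Theorem 6.12 with Props. 6.7, 6.9, 6.10 (Huong–Khoi 2024):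
the zero-Bloch-vector fibre.** `P^{(2×2)}_sep(0) = f(0) / vol_HS(D⁰) = (π⁵/39916800) / (π⁵/9676800)
= 8/33`, where `D⁰` is the set of two-qubit density matrices whose single-qubit reduced state is
`½·1₂`, `f(0) = vol_HS(D⁰ ∩ D_ss)`, `D_ss = {ρ : λ_max(ρ) ≤ ½}` (Prop. 6.9: on `D⁰`, separable ⟺
`ρ ∈ D_ss`). Rendered on the fibre chart `ℝ¹²` with `λ_max(ρ) ≤ ½` spelled `½·1 − ρ ≽ 0`.
[cite: ZhangJiangXie2025, Theorem 6.12 (proof) and Props. 6.7, 6.9, 6.10] [cite: HuongKhoi2024, main theorem] -/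
def ZhangJiangXie2025_qubit_fibre_separability_probability : Prop :=
  33 * volume {x : Fin 12 → ℝ | (qubitFibreMatrix x).PosSemidef ∧
      ((2 : ℂ)⁻¹ • (1 : Matrix (Fin 4) (Fin 4) ℂ) - qubitFibreMatrix x).PosSemidef} =
    8 * volume {x : Fin 12 → ℝ | (qubitFibreMatrix x).PosSemidef}

/-! ### Sanity lemmas (the charts are Hermitian with trace one; `T` is an involution on entries) -/

/-- The two-rebit chart has trace one. [folklore] -/
theorem trace_twoRebitMatrix (y : Fin 9 → ℝ) : (twoRebitMatrix y).trace = 1 := by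
  simp [twoRebitMatrix, Matrix.trace, Fin.sum_univ_four]
  try ring

/-- The two-rebit chart is symmetric. [folklore] -/
theorem transpose_twoRebitMatrix (y : Fin 9 → ℝ) : (twoRebitMatrix y)ᵀ = twoRebitMatrix y := by
  ext i j; fin_cases i <;> fin_cases j <;> rfl

/-- Its partial transpose is symmetric. [folklore] -/
theorem transpose_twoRebitMatrixPT (y : Fin 9 → ℝ) :
    (twoRebitMatrixPT y)ᵀ = twoRebitMatrixPT y := by
  ext i j; fin_cases i <;> fin_cases j <;> rfl

/-- The rebit fibre chart has trace one. [folklore] -/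
theorem trace_rebitFibreMatrix (x : Fin 7 → ℝ) : (rebitFibreMatrix x).trace = 1 := by
  simp [rebitFibreMatrix, Matrix.trace, Fin.sum_univ_four]
  try ring

/-- The two-qubit chart is Hermitian. [folklore] -/
theorem conjTranspose_twoQubitMatrix (y : Fin 15 → ℝ) :
    (twoQubitMatrix y)ᴴ = twoQubitMatrix y := by
  ext i j
  fin_cases i <;> fin_cases j <;>
    simp [twoQubitMatrix, Matrix.conjTranspose, Complex.ext_iff]

/-- The two-qubit chart has trace one. [folklore] -/
theorem trace_twoQubitMatrix (y : Fin 15 → ℝ) : (twoQubitMatrix y).trace = 1 := by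
  simp [twoQubitMatrix, Matrix.trace, Fin.sum_univ_four]
  try ring

/-- The qubit fibre chart is Hermitian. [folklore] -/
theorem conjTranspose_qubitFibreMatrix (x : Fin 12 → ℝ) :
    (qubitFibreMatrix x)ᴴ = qubitFibreMatrix x := by
  ext i j
  fin_cases i <;> fin_cases j <;>
    simp [qubitFibreMatrix, Matrix.conjTranspose, Complex.ext_iff]

/-- The qubit fibre chart has trace one. [folklore] -/
theorem trace_qubitFibreMatrix (x : Fin 12 → ℝ) : (qubitFibreMatrix x).trace = 1 := by
  simp [qubitFibreMatrix, Matrix.trace, Fin.sum_univ_four, Complex.ext_iff]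
  try ring

end Literature.Probability.RandomMatrix

end
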